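import Summits.Ventures.HodgeRepro.Tier4.Line1.RotationGram

/-!
# Tier4/Line1/RotationCore — LINE L1: the rotation of a hermitian plane and its general position (t4-L1-p3)

Blind re-derivation cell `pub-hodge-repro`, Tier 4 (README §9–§10), seat t4-L1-p3.  Generic linear algebra over a
field `k` (Mathlib only, no printed input), the second half of the rational rotation behind J2.d′-i
`exists_regular_rational` (assembled in `Tier4/Line1/RegularElement.lean`): `z, Om z` are linearly independent for
`z ≠ 0` when `−d` is not a square (`linearIndependent_pair_gen`), an `Om`-stable rank-2 subspace is spanned by `z, Om z`
(`range_le_span_pair_gen`), the adapted family `x, Om x, y, Om y` of two complementary `Om`-lines is a basis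
(`linearIndependent_adapted`, `isUnit_adapted`), and — the ROTATION (`exists_rotation`) — for parameters `c, s, s'` on
the conic `c²α + s²β = α`, `s'α = sβ` there is an `Om`-linear `B`-isometry `r = S R S⁻¹` with `r x = c x + s y`,
`r y = −s' x + c y` (`S` = the adapted basis matrix, `R = R(c, s, s')` of `RotationGram`); finally `general_position`:
such an `r` with `c s s' ≠ 0` moves every non-zero vector of either line to a vector with both components non-zero.

Nothing here says anything about the status of the Hodge conjecture for CM abelian varieties, which is NOT proved
(HC_CM is NOT proved by anyone in this repository).
-/

set_option autoImplicit false

noncomputable section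

namespace Summit.Ventures.HodgeRepro.Tier4.Line1.Rot

open Matrix

variable {k : Type} [Field k] [CharZero k]


omit [CharZero k] in
/-- `z, Om z` are linearly independent for `z ≠ 0` when `Om² = -d` with `-d` not a square. -/
theorem linearIndependent_pair_gen {Om : Matrix (Fin 4) (Fin 4) k} {d : k}
    (hOm : Om * Om = -(d • (1 : Matrix (Fin 4) (Fin 4) k))) (hd : ¬ IsSquare (-d))
    {z : Fin 4 → k} (hz : z ≠ 0) : LinearIndependent k ![z, Om *ᵥ z] := by
  rw [LinearIndependent.pair_iff]
  intro s t hst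
  by_cases ht : t = 0
  · subst ht
    simp only [zero_smul, add_zero, smul_eq_zero] at hst
    exact ⟨hst.resolve_right hz, rfl⟩
  · exfalso
    have h1 : Om *ᵥ z = (-(s / t)) • z := by
      have h0 : t • (Om *ᵥ z) = -(s • z) := by
        rw [eq_neg_iff_add_eq_zero, add_comm]
        exact hst
      calc Om *ᵥ z = t⁻¹ • (t • (Om *ᵥ z)) := by rw [smul_smul, inv_mul_cancel₀ ht, one_smul]
        _ = t⁻¹ • (-(s • z)) := by rw [h0]
        _ = (-(s / t)) • z := by rw [smul_neg, smul_smul, neg_smul, div_eq_inv_mul]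
    set c := -(s / t) with hc
    have h2 : Om *ᵥ (Om *ᵥ z) = (c * c) • z := by
      rw [h1, mulVec_smul, h1, smul_smul]
    have h3 : Om *ᵥ (Om *ᵥ z) = (-d) • z := by
      rw [mulVec_mulVec, hOm, neg_mulVec, smul_mulVec, one_mulVec, neg_smul]
    have h4 : (c * c - (-d)) • z = 0 := by
      rw [sub_smul, ← h2, ← h3, sub_self]
    rcases smul_eq_zero.mp h4 with h | h
    · exact hd ⟨c, by linear_combination -h⟩
    · exact hz h

omit [CharZero k] in
/-- the adapted family `x, Om x, y, Om y` of two complementary `Om`-lines is linearly independent. -/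
theorem linearIndependent_adapted {Om p₀ : Matrix (Fin 4) (Fin 4) k} {d : k}
    (hOm : Om * Om = -(d • (1 : Matrix (Fin 4) (Fin 4) k))) (hd : ¬ IsSquare (-d))
    (hp₀Om : p₀ * Om = Om * p₀) {x y : Fin 4 → k} (hx : x ≠ 0) (hy : y ≠ 0)
    (hx0 : p₀ *ᵥ x = x) (hy0 : p₀ *ᵥ y = 0) :
    LinearIndependent k ![x, Om *ᵥ x, y, Om *ᵥ y] := by
  have hxp := linearIndependent_pair_gen hOm hd hx
  have hyp := linearIndependent_pair_gen hOm hd hy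
  rw [Fintype.linearIndependent_iff]
  intro g hg
  simp only [Fin.sum_univ_four, Matrix.cons_val_zero, Matrix.cons_val_one, Matrix.head_cons,
    Matrix.cons_val_two, Matrix.cons_val_three, Matrix.tail_cons] at hg
  have hOx0 : p₀ *ᵥ (Om *ᵥ x) = Om *ᵥ x := by
    rw [mulVec_mulVec, hp₀Om, ← mulVec_mulVec, hx0]
  have hOy0 : p₀ *ᵥ (Om *ᵥ y) = 0 := by
    rw [mulVec_mulVec, hp₀Om, ← mulVec_mulVec, hy0, mulVec_zero]
  have h1 : g 0 • x + g 1 • (Om *ᵥ x) = 0 := by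
    have := congrArg (fun v => p₀ *ᵥ v) hg
    simpa [mulVec_add, mulVec_smul, hx0, hOx0, hy0, hOy0] using this
  obtain ⟨h0, h1'⟩ := LinearIndependent.pair_iff.mp hxp (g 0) (g 1) h1
  have h2 : g 2 • y + g 3 • (Om *ᵥ y) = 0 := by
    rw [h0, h1', zero_smul, zero_smul, zero_add, zero_add] at hg
    exact hg
  obtain ⟨h2', h3'⟩ := LinearIndependent.pair_iff.mp hyp (g 2) (g 3) h2
  intro i
  fin_cases i <;> assumption

omit [CharZero k] in
/-- the adapted matrix `S` (columns `x, Om x, y, Om y`) is invertible. -/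
theorem isUnit_adapted {Om p₀ : Matrix (Fin 4) (Fin 4) k} {d : k}
    (hOm : Om * Om = -(d • (1 : Matrix (Fin 4) (Fin 4) k))) (hd : ¬ IsSquare (-d))
    (hp₀Om : p₀ * Om = Om * p₀) {x y : Fin 4 → k} (hx : x ≠ 0) (hy : y ≠ 0)
    (hx0 : p₀ *ᵥ x = x) (hy0 : p₀ *ᵥ y = 0) :
    IsUnit (Matrix.of fun i j => ![x, Om *ᵥ x, y, Om *ᵥ y] j i) := by
  rw [← Matrix.linearIndependent_cols_iff_isUnit]
  exact linearIndependent_adapted hOm hd hp₀Om hx hy hx0 hy0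


omit [CharZero k] in
/-- the rotation block matrix is invertible: `R(c, s, s') R(c, -s, -s') = 1` when `c² + s s' = 1`. -/
theorem rot_mul_rot_neg {c s s' : k} (h : c * c + s * s' = 1) :
    Matrix.of ![![c, 0, -s', 0], ![0, c, 0, -s'], ![s, 0, c, 0], ![0, s, 0, c]] *
      Matrix.of ![![c, 0, s', 0], ![0, c, 0, s'], ![-s, 0, c, 0], ![0, -s, 0, c]] = 1 := by
  ext i j
  fin_cases i <;> fin_cases j <;> simp [Matrix.mul_apply, Fin.sum_univ_four] <;>
    first
    | linear_combination h
    | ring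

/-- **the rotation**: for two `B`-orthogonal, complementary `Om`-lines spanned by `x`, `y` and rotation parameters
`c, s, s'` with `c²α + s²β = α`, `s'α = sβ` (`α = β(x,x)`, `β = β(y,y)`), there is an `Om`-linear `B`-isometry `r` with
`r x = c x + s y` and `r y = -s' x + c y`. -/
theorem exists_rotation {B Om p₀ : Matrix (Fin 4) (Fin 4) k} {d : k} (hB : Bᵀ = B)
    (hherm : Omᵀ * B = -(B * Om)) (hOm : Om * Om = -(d • (1 : Matrix (Fin 4) (Fin 4) k)))
    (hd : ¬ IsSquare (-d)) (hp₀Om : p₀ * Om = Om * p₀) {x y : Fin 4 → k} (hx : x ≠ 0) (hy : y ≠ 0)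
    (hx0 : p₀ *ᵥ x = x) (hy0 : p₀ *ᵥ y = 0) (hxy : x ⬝ᵥ (B *ᵥ y) = 0)
    (hxOy : x ⬝ᵥ (B *ᵥ (Om *ᵥ y)) = 0) (hα : x ⬝ᵥ (B *ᵥ x) ≠ 0) {c s s' : k}
    (hc : c * c * (x ⬝ᵥ (B *ᵥ x)) + s * s * (y ⬝ᵥ (B *ᵥ y)) = x ⬝ᵥ (B *ᵥ x))
    (hs' : s' * (x ⬝ᵥ (B *ᵥ x)) = s * (y ⬝ᵥ (B *ᵥ y))) :
    ∃ r : Matrix (Fin 4) (Fin 4) k, r * Om = Om * r ∧ rᵀ * B * r = B ∧ IsUnit r ∧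
      r *ᵥ x = c • x + s • y ∧ r *ᵥ y = (-s') • x + c • y := by
  set S : Matrix (Fin 4) (Fin 4) k := Matrix.of fun i j => ![x, Om *ᵥ x, y, Om *ᵥ y] j i with hSdef
  set R : Matrix (Fin 4) (Fin 4) k :=
    Matrix.of ![![c, 0, -s', 0], ![0, c, 0, -s'], ![s, 0, c, 0], ![0, s, 0, c]] with hRdef
  set Jb : Matrix (Fin 4) (Fin 4) k :=
    Matrix.of ![![0, -d, 0, 0], ![1, 0, 0, 0], ![0, 0, 0, -d], ![0, 0, 1, 0]] with hJdef
  set G : Matrix (Fin 4) (Fin 4) k :=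
    Matrix.diagonal ![x ⬝ᵥ (B *ᵥ x), d * (x ⬝ᵥ (B *ᵥ x)), y ⬝ᵥ (B *ᵥ y), d * (y ⬝ᵥ (B *ᵥ y))]
    with hGdef
  have hS : IsUnit S := isUnit_adapted hOm hd hp₀Om hx hy hx0 hy0
  have hSdet : IsUnit S.det := (Matrix.isUnit_iff_isUnit_det S).mp hS
  have hSS : S * S⁻¹ = 1 := Matrix.mul_nonsing_inv S hSdet
  have hSS' : S⁻¹ * S = 1 := Matrix.nonsing_inv_mul S hSdet
  have hcan : ∀ X : Matrix (Fin 4) (Fin 4) k, S⁻¹ * (S * X) = X := fun X => by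
    rw [← Matrix.mul_assoc, hSS', Matrix.one_mul]
  have hcanT : ∀ X : Matrix (Fin 4) (Fin 4) k, Sᵀ * (S⁻¹ᵀ * X) = X := fun X => by
    rw [← Matrix.mul_assoc, ← Matrix.transpose_mul, hSS', Matrix.transpose_one, Matrix.one_mul]
  have hOmS : Om * S = S * Jb := mul_adapted_eq hOm x y
  have hRJ : R * Jb = Jb * R := rot_comm_J c s s' d
  have hG : Sᵀ * B * S = G := gram_adapted hB hherm hOm x y hxy hxOy
  have hRG : Rᵀ * G * R = G := rot_isometry hα hc hs'
  have hcs : c * c + s * s' = 1 := by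
    apply mul_right_cancel₀ hα
    linear_combination hc + s * hs'
  have hRunit : IsUnit R := by
    have h1 := rot_mul_rot_neg hcs
    have h2 := mul_eq_one_comm.mp h1
    exact ⟨⟨R, _, h1, h2⟩, rfl⟩
  refine ⟨S * R * S⁻¹, ?_, ?_, ?_, ?_, ?_⟩
  · -- commutation with `Om`
    have hOm' : Om = S * Jb * S⁻¹ := by
      rw [← hOmS, Matrix.mul_assoc, hSS, Matrix.mul_one]
    rw [hOm']
    simp only [Matrix.mul_assoc, hcan]
    rw [← Matrix.mul_assoc R Jb, hRJ, Matrix.mul_assoc]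
  · -- isometry
    have hB' : B = S⁻¹ᵀ * G * S⁻¹ := by
      rw [← hG]
      calc B = (S⁻¹ᵀ * Sᵀ) * B * (S * S⁻¹) := by
            rw [← Matrix.transpose_mul, hSS, Matrix.transpose_one, Matrix.one_mul, Matrix.mul_one]
        _ = S⁻¹ᵀ * (Sᵀ * B * S) * S⁻¹ := by simp only [Matrix.mul_assoc]
    have key : S⁻¹ᵀ * (Rᵀ * (G * (R * S⁻¹))) = S⁻¹ᵀ * (G * S⁻¹) := by
      calc S⁻¹ᵀ * (Rᵀ * (G * (R * S⁻¹))) = S⁻¹ᵀ * ((Rᵀ * G * R) * S⁻¹) := by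
            simp only [Matrix.mul_assoc]
        _ = S⁻¹ᵀ * (G * S⁻¹) := by rw [hRG]
    rw [Matrix.transpose_mul, Matrix.transpose_mul, hB']
    simp only [Matrix.mul_assoc, hcan, hcanT]
    exact key
  · exact (hS.mul hRunit).mul (Matrix.isUnit_nonsing_inv_iff.mpr hS)
  · -- `r x = c x + s y`
    have hx' : S *ᵥ Pi.single 0 1 = x := by
      rw [mulVec_single_one]
      rfl
    have hSx : S⁻¹ *ᵥ x = Pi.single 0 1 := by
      rw [← hx', mulVec_mulVec, hSS', one_mulVec]
    rw [← mulVec_mulVec x (S * R) S⁻¹, hSx, ← mulVec_mulVec]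
    ext i
    simp [S, R, Matrix.mulVec, dotProduct, Fin.sum_univ_four]
    ring
  · -- `r y = -s' x + c y`
    have hy' : S *ᵥ Pi.single 2 1 = y := by
      rw [mulVec_single_one]
      rfl
    have hSy : S⁻¹ *ᵥ y = Pi.single 2 1 := by
      rw [← hy', mulVec_mulVec, hSS', one_mulVec]
    rw [← mulVec_mulVec y (S * R) S⁻¹, hSy, ← mulVec_mulVec]
    ext i
    simp [S, R, Matrix.mulVec, dotProduct, Fin.sum_univ_four]
    ring

omit [CharZero k] in
/-- an `Om`-stable rank-`2` subspace (an `E′`-line) is spanned by `z, Om z` for any non-zero `z` in it. -/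
theorem range_le_span_pair_gen {Om : Matrix (Fin 4) (Fin 4) k} {d : k}
    (hOm : Om * Om = -(d • (1 : Matrix (Fin 4) (Fin 4) k))) (hd : ¬ IsSquare (-d))
    {A : Matrix (Fin 4) (Fin 4) k} (hA : A * Om = Om * A) (hr : A.rank = 2)
    {z : Fin 4 → k} (hz : z ≠ 0) (hzA : z ∈ LinearMap.range A.mulVecLin) :
    LinearMap.range A.mulVecLin ≤ Submodule.span k {z, Om *ᵥ z} := by
  have hle : Submodule.span k {z, Om *ᵥ z} ≤ LinearMap.range A.mulVecLin := by
    rw [Submodule.span_le]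
    rintro v hv
    simp only [Set.mem_insert_iff, Set.mem_singleton_iff] at hv
    rcases hv with rfl | rfl
    · exact hzA
    · obtain ⟨w, hw⟩ := hzA
      refine ⟨Om *ᵥ w, ?_⟩
      simp only [mulVecLin_apply] at hw ⊢
      rw [mulVec_mulVec, hA, ← mulVec_mulVec, hw]
  have hfin : Module.finrank k (Submodule.span k {z, Om *ᵥ z}) = 2 := by
    have h := finrank_span_eq_card (R := k) (linearIndependent_pair_gen hOm hd hz)
    have hr' : Set.range ![z, Om *ᵥ z] = {z, Om *ᵥ z} := by
      ext v
      simp only [Set.mem_range, Set.mem_insert_iff, Set.mem_singleton_iff, Fin.exists_fin_two,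
        Matrix.cons_val_zero, Matrix.cons_val_one]
      constructor
      · rintro (h | h) <;> [left; right] <;> exact h.symm
      · rintro (h | h) <;> [left; right] <;> exact h.symm
    rw [hr'] at h
    simpa using h
  have hr' : Module.finrank k (LinearMap.range A.mulVecLin) = 2 := hr
  exact (Submodule.eq_of_le_of_finrank_eq hle (hfin.trans hr'.symm)).ge

omit [CharZero k] in
/-- **general position**: the rotation `r` moves every non-zero vector of either `Om`-line to a vector with both
components non-zero. -/
theorem general_position {Om p₀ p₁ r : Matrix (Fin 4) (Fin 4) k} {d : k}
    (hOm : Om * Om = -(d • (1 : Matrix (Fin 4) (Fin 4) k))) (hd : ¬ IsSquare (-d))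
    (hp₀Om : p₀ * Om = Om * p₀) (hp₁Om : p₁ * Om = Om * p₁)
    (h01 : p₀ * p₁ = 0) (h10 : p₁ * p₀ = 0) (hp₀r : p₀.rank = 2) (hp₁r : p₁.rank = 2)
    {x y : Fin 4 → k} (hx : x ≠ 0) (hy : y ≠ 0) (hx0 : p₀ *ᵥ x = x) (hy1 : p₁ *ᵥ y = y)
    (hfix₀ : ∀ v ∈ LinearMap.range p₀.mulVecLin, p₀ *ᵥ v = v)
    (hfix₁ : ∀ v ∈ LinearMap.range p₁.mulVecLin, p₁ *ᵥ v = v)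
    (hrOm : r * Om = Om * r) {c s s' : k} (hc0 : c ≠ 0) (hs0 : s ≠ 0) (hs'0 : s' ≠ 0)
    (hrx : r *ᵥ x = c • x + s • y) (hry : r *ᵥ y = (-s') • x + c • y)
    {q : Fin 4 → k} (hq : q ∈ LinearMap.range p₀.mulVecLin ∨ q ∈ LinearMap.range p₁.mulVecLin)
    (hq0 : q ≠ 0) : p₀ *ᵥ (r *ᵥ q) ≠ 0 ∧ p₁ *ᵥ (r *ᵥ q) ≠ 0 := by
  -- the lines kill each other
  have hk01 : ∀ v ∈ LinearMap.range p₁.mulVecLin, p₀ *ᵥ v = 0 := by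
    intro v hv
    rw [← hfix₁ v hv, mulVec_mulVec, h01, zero_mulVec]
  have hk10 : ∀ v ∈ LinearMap.range p₀.mulVecLin, p₁ *ᵥ v = 0 := by
    intro v hv
    rw [← hfix₀ v hv, mulVec_mulVec, h10, zero_mulVec]
  have hOmem₀ : ∀ v ∈ LinearMap.range p₀.mulVecLin, Om *ᵥ v ∈ LinearMap.range p₀.mulVecLin := by
    intro v hv
    obtain ⟨w, hw⟩ := hv
    refine ⟨Om *ᵥ w, ?_⟩
    simp only [mulVecLin_apply] at hw ⊢
    rw [mulVec_mulVec, hp₀Om, ← mulVec_mulVec, hw]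
  have hOmem₁ : ∀ v ∈ LinearMap.range p₁.mulVecLin, Om *ᵥ v ∈ LinearMap.range p₁.mulVecLin := by
    intro v hv
    obtain ⟨w, hw⟩ := hv
    refine ⟨Om *ᵥ w, ?_⟩
    simp only [mulVecLin_apply] at hw ⊢
    rw [mulVec_mulVec, hp₁Om, ← mulVec_mulVec, hw]
  have hxmem : x ∈ LinearMap.range p₀.mulVecLin := ⟨x, hx0⟩
  have hymem : y ∈ LinearMap.range p₁.mulVecLin := ⟨y, hy1⟩
  have hxOm : r *ᵥ (Om *ᵥ x) = Om *ᵥ (c • x + s • y) := by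
    rw [mulVec_mulVec, hrOm, ← mulVec_mulVec, hrx]
  have hyOm : r *ᵥ (Om *ᵥ y) = Om *ᵥ ((-s') • x + c • y) := by
    rw [mulVec_mulVec, hrOm, ← mulVec_mulVec, hry]
  have hxpair := LinearIndependent.pair_iff.mp (linearIndependent_pair_gen hOm hd hx)
  have hypair := LinearIndependent.pair_iff.mp (linearIndependent_pair_gen hOm hd hy)
  rcases hq with hq | hq
  · -- `q = a x + b Om x`
    obtain ⟨a, b, hab⟩ := Submodule.mem_span_pair.mp
      (range_le_span_pair_gen hOm hd hp₀Om hp₀r hx hxmem hq)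
    have hab0 : ¬ (a = 0 ∧ b = 0) := by
      rintro ⟨ha, hb⟩
      apply hq0
      rw [← hab, ha, hb, zero_smul, zero_smul, add_zero]
    obtain ⟨y', hy'⟩ : ∃ y' : Fin 4 → k, y' = a • y + b • (Om *ᵥ y) := ⟨_, rfl⟩
    have hy'mem : y' ∈ LinearMap.range p₁.mulVecLin := by
      rw [hy']
      exact Submodule.add_mem _ (Submodule.smul_mem _ _ hymem)
        (Submodule.smul_mem _ _ (hOmem₁ y hymem))
    have hy'0 : y' ≠ 0 := by
      intro h
      rw [hy'] at h
      exact hab0 (hypair a b h)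
    have hrq : r *ᵥ q = c • q + s • y' := by
      rw [← hab, hy', mulVec_add, mulVec_smul, mulVec_smul, hrx, hxOm, mulVec_add, mulVec_smul,
        mulVec_smul]
      simp only [smul_add, smul_smul]
      module
    rw [hrq, mulVec_add, mulVec_smul, mulVec_smul, mulVec_add, mulVec_smul, mulVec_smul,
      hfix₀ q hq, hk01 y' hy'mem, hk10 q hq, hfix₁ y' hy'mem, smul_zero, smul_zero, add_zero, zero_add]
    exact ⟨smul_ne_zero hc0 hq0, smul_ne_zero hs0 hy'0⟩
  · -- `q = a y + b Om y`
    obtain ⟨a, b, hab⟩ := Submodule.mem_span_pair.mp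
      (range_le_span_pair_gen hOm hd hp₁Om hp₁r hy hymem hq)
    have hab0 : ¬ (a = 0 ∧ b = 0) := by
      rintro ⟨ha, hb⟩
      apply hq0
      rw [← hab, ha, hb, zero_smul, zero_smul, add_zero]
    obtain ⟨x', hx'⟩ : ∃ x' : Fin 4 → k, x' = a • x + b • (Om *ᵥ x) := ⟨_, rfl⟩
    have hx'mem : x' ∈ LinearMap.range p₀.mulVecLin := by
      rw [hx']
      exact Submodule.add_mem _ (Submodule.smul_mem _ _ hxmem)
        (Submodule.smul_mem _ _ (hOmem₀ x hxmem))
    have hx'0 : x' ≠ 0 := by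
      intro h
      rw [hx'] at h
      exact hab0 (hxpair a b h)
    have hrq : r *ᵥ q = (-s') • x' + c • q := by
      rw [← hab, hx', mulVec_add, mulVec_smul, mulVec_smul, hry, hyOm, mulVec_add, mulVec_smul,
        mulVec_smul]
      simp only [smul_add, smul_smul]
      module
    rw [hrq, mulVec_add, mulVec_smul, mulVec_smul, mulVec_add, mulVec_smul, mulVec_smul,
      hfix₀ x' hx'mem, hk01 q hq, hk10 x' hx'mem, hfix₁ q hq, smul_zero, smul_zero, add_zero, zero_add]
    exact ⟨smul_ne_zero (neg_ne_zero.mpr hs'0) hx'0, smul_ne_zero hc0 hq0⟩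

end Summit.Ventures.HodgeRepro.Tier4.Line1.Rot
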